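import Summits.CriticalPhenomena.SAWScalingLimit.Theorems.SAWDevelopingMapInteriorFlatteningOneMouthDefs
import Literature.Probability.RandomPlanarGeometry.HexParafermionProofs
import Literature.Probability.RandomPlanarGeometry.HexMidEdgeSAWDoors
import Mathlib.Data.List.DropRight

/-!
# Exact last-entrance factorisation (stub `stub_factorisation`, line `one-mouth-ball-reduction`)

Crux `stmt-CriticalPhenomena-8297` (`…Theses.SAWDevelopingMap.InteriorFlattening`), line
`one-mouth-ball-reduction`, registered stub `stub_factorisation` (statement S1 of the lead's
skeleton), over the objects `Fobs`, `Conf`, `root`, `amp` of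
`…Theorems.SAWDevelopingMapInteriorFlatteningOneMouthDefs`: for `S ⊆ Λ`, a root mid-edge `a`
with both endpoints off `S`, and `x, y ∈ S`,
`F_{Λ,a}({x,y}) = Σ_{c ∈ Conf Λ S} amp(c) · F_{D_c, root c}({x,y})`.

**Proof (exact finite combinatorics).** A walk `ω : a → {x,y}` of `Λ` is nonempty, starts off
`S` and ends in `S`; cut its vertex list at its LAST vertex `u ∉ S`: `ω.verts = P ++ Q`, `P`
ending at `u` (`P = rdropWhile (· ∈ S)`), `Q ⊆ S` starting at `u'` (`Q = rtakeWhile (· ∈ S)`).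
`P` is an outer walk `a → {u,u'}` of `Λ` ending at `u`, `Q` an inner walk `{u,u'} → {x,y}` of
`D = S ∖ P` (`exists_cut`); conversely such a pair glues to a walk of `Λ` whose cut returns it
(`exists_glue`, `rdropWhile_rtakeWhile_of_append`). Lengths add and windings add exactly, the
mid-edge `mid{u,u'}` lying on the segment `[c_u, c_{u'}]` (`winding_append_cons_cons`,
`winding_concat_right_ray`, `winding_cons_left_ray`), so the weight `e^{-iσW} x_c^ℓ` is
multiplicative (`weight_split`). Grouping the walks by their configuration `(D, (u, u'))`
(`cfg_mem_Conf`, `Finset.sum_fiberwise_of_maps_to`) and applying the bijection on each group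
(`fiber_sum_eq`) gives the identity. [folklore] walk surgery (Madras–Slade 1993, §3–§4) for the
mid-edge walks of Duminil-Copin–Smirnov 2012, §1–§2; axioms `propext, Classical.choice, Quot.sound`.
-/

noncomputable section

open scoped BigOperators
open Literature.Probability.LatticeModels Literature.Probability.RandomPlanarGeometry.SAW

namespace Summit.CriticalPhenomena.SAWScalingLimit.Theorems.InteriorFlattening.OneMouth

namespace LastEntrance

/-- The split of `A ++ B` at its last entry failing `p = (· ∈ S)`, when `A` ends outside `S` and
`B ⊆ S`: the outer block `rdropWhile p` is `A`, the inner block `rtakeWhile p` is `B`. -/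
theorem rdropWhile_rtakeWhile_of_append {S : Finset HexVertex} {p : HexVertex → Bool}
    (hp : ∀ v, p v = true ↔ v ∈ S) {A B : List HexVertex} {u : HexVertex}
    (hA : A.getLast? = some u) (hu : u ∉ S) (hB : ∀ b ∈ B, b ∈ S) :
    (A ++ B).rdropWhile p = A ∧ (A ++ B).rtakeWhile p = B := by
  have hne : A ≠ [] := by rintro rfl; simp at hA
  obtain ⟨A', rfl⟩ : ∃ A', A = A' ++ [u] := by
    rw [List.getLast?_eq_some_getLast hne, Option.some.injEq] at hA
    exact ⟨A.dropLast, by rw [← hA, List.dropLast_append_getLast hne]⟩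
  have hB' : ∀ b ∈ B.reverse, p b = true := fun b hb => (hp b).2 (hB b (List.mem_reverse.1 hb))
  have hu' : ¬ (p u = true) := by rwa [hp]
  have hrev : (A' ++ [u] ++ B).reverse = B.reverse ++ u :: A'.reverse := by simp
  constructor
  · rw [List.rdropWhile, hrev, List.dropWhile_append_of_pos hB', List.dropWhile_cons_of_neg hu',
      List.reverse_cons, List.reverse_reverse]
  · rw [List.rtakeWhile, hrev, List.takeWhile_append_of_pos hB', List.takeWhile_cons_of_neg hu',
      List.append_nil, List.reverse_reverse]

/-- **Windings add at an interior mid-edge**: the winding of `A, p, q, B` is the winding of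
`A, p, (p+q)/2` plus that of `(p+q)/2, q, B` (the midpoint lies on the segment `[p, q]`). -/
theorem winding_split_mid (A : List ℂ) (p q : ℂ) (B : List ℂ) :
    Polyline.winding (A ++ p :: q :: B) =
      Polyline.winding (A ++ [p, (p + q) / 2]) + Polyline.winding ((p + q) / 2 :: q :: B) := by
  rw [winding_append_cons_cons]
  have h1 : (p + q) / 2 = p + ((1 / 2 : ℝ) : ℂ) * (q - p) := by push_cast; ring
  have h2 : (p + q) / 2 = q + ((1 / 2 : ℝ) : ℂ) * (p - q) := by push_cast; ring
  congr 1
  · rw [h1, winding_concat_right_ray (by norm_num : (0 : ℝ) < 1 / 2)]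
  · rw [h2, winding_cons_left_ray (by norm_num : (0 : ℝ) < 1 / 2)]

/-- **Multiplicativity of the weight `e^{-iσW} t^ℓ`**: for `P` ending at `u` and `Q` starting at
`u'`, the weight of the polyline of `P ++ Q` from `mid a` to `mid z` is the weight of `P` from
`mid a` to `mid{u,u'}` times the weight of `Q` from `mid{u,u'}` to `mid z` (lengths add; windings
add exactly at `mid{u,u'}`). On walks these are the `HexMidEdgeSAW.weight`s, by `rfl`. -/
theorem weight_split {a z : Sym2 HexVertex} {P Q : List HexVertex} {u u' : HexVertex}
    (hP : P.getLast? = some u) (hQ : Q.head? = some u') (σ t : ℝ) :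
    Complex.exp (-Complex.I * σ *
          (Polyline.winding (hexMidpoint a :: (P ++ Q).map hexCenter ++ [hexMidpoint z]) : ℝ)) *
        (t : ℂ) ^ (P ++ Q).length =
      Complex.exp (-Complex.I * σ *
            (Polyline.winding (hexMidpoint a :: P.map hexCenter ++ [hexMidpoint s(u, u')]) : ℝ)) *
          (t : ℂ) ^ P.length *
        (Complex.exp (-Complex.I * σ *
            (Polyline.winding (hexMidpoint s(u, u') :: Q.map hexCenter ++ [hexMidpoint z]) : ℝ)) *
          (t : ℂ) ^ Q.length) := by
  have hne : P ≠ [] := by rintro rfl; simp at hP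
  obtain ⟨P', rfl⟩ : ∃ P', P = P' ++ [u] := by
    rw [List.getLast?_eq_some_getLast hne, Option.some.injEq] at hP
    exact ⟨P.dropLast, by rw [← hP, List.dropLast_append_getLast hne]⟩
  obtain ⟨Q', rfl⟩ : ∃ Q', Q = u' :: Q' := by
    cases Q with
    | nil => simp at hQ
    | cons q Q' => exact ⟨Q', by rw [List.head?_cons, Option.some.injEq] at hQ; rw [hQ]⟩
  have hW : Polyline.winding
      (hexMidpoint a :: List.map hexCenter (P' ++ [u] ++ u' :: Q') ++ [hexMidpoint z]) =
      Polyline.winding (hexMidpoint a :: List.map hexCenter (P' ++ [u]) ++ [hexMidpoint s(u, u')]) +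
        Polyline.winding
          (hexMidpoint s(u, u') :: List.map hexCenter (u' :: Q') ++ [hexMidpoint z]) := by
    have h := winding_split_mid (hexMidpoint a :: P'.map hexCenter) (hexCenter u) (hexCenter u')
      (Q'.map hexCenter ++ [hexMidpoint z])
    rw [← hexMidpoint_mk] at h
    simpa only [List.map_append, List.map_cons, List.map_nil, List.cons_append, List.append_assoc,
      List.nil_append] using h
  rw [hW, Complex.ofReal_add, mul_add, Complex.exp_add, List.length_append, pow_add]
  ring

/-- **Cutting.** A walk `a → {x,y}` of `Λ` whose vertex list splits as `P ++ Q` with `P` ending at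
`u`, `Q` starting at `u'` and `Q ⊆ S` is an outer walk `a → {u,u'}` of `Λ` with vertex list `P`
followed by an inner walk `{u,u'} → {x,y}` of `D = S ∖ P` with vertex list `Q`. -/
theorem exists_cut {Λ S D : Finset HexVertex} {a : Sym2 HexVertex} {x y u u' : HexVertex}
    (ω : HexMidEdgeSAW Λ a s(x, y)) {P Q : List HexVertex} (hdec : ω.verts = P ++ Q)
    (hP : P.getLast? = some u) (hQ : Q.head? = some u') (hQS : ∀ q ∈ Q, q ∈ S)
    (hD : S \ P.toFinset = D) :
    ∃ (γ : HexMidEdgeSAW Λ a s(u, u')) (β : HexMidEdgeSAW D s(u, u') s(x, y)),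
      γ.verts = P ∧ β.verts = Q := by
  subst hD
  have hPne : P ≠ [] := by rintro rfl; simp at hP
  obtain ⟨Q', rfl⟩ : ∃ Q', Q = u' :: Q' := by
    cases Q with
    | nil => simp at hQ
    | cons q Q' => exact ⟨Q', by rw [List.head?_cons, Option.some.injEq] at hQ; rw [hQ]⟩
  have hne : ω.verts ≠ [] := by rw [hdec]; simp [hPne]
  have hnd : (P ++ u' :: Q').Nodup := hdec ▸ ω.nodup
  obtain ⟨hPn, hQn, hPQ⟩ := List.nodup_append.1 hnd
  have hch : (P ++ u' :: Q').IsChain hexGraph.Adj := hdec ▸ ω.isChain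
  obtain ⟨hPc, hQc, hjn⟩ := List.isChain_append.1 hch
  have huu' : hexGraph.Adj u u' :=
    hjn u (by rw [Option.mem_def, hP]) u' (by rw [Option.mem_def, List.head?_cons])
  have hQD : ∀ q ∈ u' :: Q', q ∈ S \ P.toFinset := fun q hq =>
    Finset.mem_sdiff.2 ⟨hQS q hq, fun h => hPQ q (List.mem_toFinset.1 h) q hq rfl⟩
  have hE : a :: List.zipWith (fun v w => s(v, w)) ω.verts ω.verts.tail ++ [s(x, y)] =
      (a :: List.zipWith (fun v w => s(v, w)) P P.tail ++ [s(u, u')]) ++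
        (List.zipWith (fun v w => s(v, w)) (u' :: Q') (u' :: Q').tail ++ [s(x, y)]) := by
    rw [hdec, edges_append_cons, edges_concat hP]
    simp only [List.cons_append, List.append_assoc, List.nil_append]
  have hN := ω.edges_nodup hne
  rw [hE] at hN
  have hN1 := hN.sublist (List.sublist_append_left _ _)
  rw [List.append_assoc] at hN
  have hN2 := hN.sublist (List.sublist_append_right _ _)
  refine ⟨⟨P, fun v hv => ω.subset v (by rw [hdec]; exact List.mem_append_left _ hv), hPn, hPc,
      ?_, ?_, fun h => absurd h hPne, fun _ => hN1, ω.fst_mem⟩,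
    ⟨u' :: Q', hQD, hQn, hQc, ?_, ?_, fun h => absurd h (List.cons_ne_nil _ _), fun _ => hN2, ?_⟩,
    rfl, rfl⟩
  · intro v hv
    exact ω.head_mem v (by rw [hdec, List.head?_append, hv, Option.some_or])
  · intro v hv; rw [hP, Option.some.injEq] at hv; subst hv; exact Sym2.mem_mk_left _ _
  · intro v hv
    rw [List.head?_cons, Option.some.injEq] at hv; subst hv; exact Sym2.mem_mk_right _ _
  · intro v hv
    exact ω.getLast_mem v (by rw [hdec, List.getLast?_append, hv, Option.some_or])
  · exact ⟨(SimpleGraph.mem_edgeSet _).2 huu', u', Sym2.mem_mk_right _ _,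
      hQD u' List.mem_cons_self⟩

/-- An inner walk `{u,u'} → {x,y}` of `D ⊆ S` (`u ∉ S`, `x, y ∈ S`) is nonempty and starts at
`u'`. -/
theorem inner_head {D S : Finset HexVertex} {u u' x y : HexVertex}
    (β : HexMidEdgeSAW D s(u, u') s(x, y)) (hDS : D ⊆ S) (hu : u ∉ S) (hx : x ∈ S) (hy : y ∈ S) :
    β.verts ≠ [] ∧ β.verts.head? = some u' := by
  have hne : β.verts ≠ [] := fun h => by
    have hu' : u ∈ s(x, y) := by rw [← β.eq_of_nil h]; exact Sym2.mem_mk_left u u'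
    rcases Sym2.mem_iff.1 hu' with rfl | rfl
    exacts [hu hx, hu hy]
  exact ⟨hne, β.head?_eq_of_door rfl (fun h => hu (hDS h)) hne⟩

/-- **Gluing.** An outer walk `γ : a → {u,u'}` of `Λ` ending at `u ∉ S` (`a` off `S`, `u ∼ u'`)
followed by an inner walk `β : {u,u'} → {x,y}` of `D = S ∖ γ` (`x, y ∈ S ⊆ Λ`) is a walk
`a → {x,y}` of `Λ` with vertex list `γ.verts ++ β.verts`. -/
theorem exists_glue {Λ S D : Finset HexVertex} {a : Sym2 HexVertex} {x y u u' : HexVertex}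
    (hSΛ : S ⊆ Λ) (haS : ∀ t ∈ a, t ∉ S) (hx : x ∈ S) (hy : y ∈ S) (hu : u ∉ S)
    (huu' : hexGraph.Adj u u') (γ : HexMidEdgeSAW Λ a s(u, u'))
    (hγu : γ.verts.getLast? = some u) (hγD : S \ γ.verts.toFinset = D)
    (β : HexMidEdgeSAW D s(u, u') s(x, y)) :
    ∃ ω : HexMidEdgeSAW Λ a s(x, y), ω.verts = γ.verts ++ β.verts := by
  subst hγD
  have hγne : γ.verts ≠ [] := by intro h; rw [h] at hγu; simp at hγu
  obtain ⟨hβne, hβh⟩ := inner_head β Finset.sdiff_subset hu hx hy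
  have hβS : ∀ v ∈ β.verts, v ∈ S ∧ v ∉ γ.verts := fun v hv => by
    simpa only [Finset.mem_sdiff, List.mem_toFinset] using β.subset v hv
  obtain ⟨Q', hQ⟩ : ∃ Q', β.verts = u' :: Q' := by
    obtain ⟨q, Q', h⟩ := List.exists_cons_of_ne_nil hβne
    rw [h, List.head?_cons, Option.some.injEq] at hβh
    exact ⟨Q', hβh ▸ h⟩
  have hE : a :: List.zipWith (fun v w => s(v, w)) (γ.verts ++ β.verts) (γ.verts ++ β.verts).tail ++
        [s(x, y)] =
      (a :: List.zipWith (fun v w => s(v, w)) γ.verts γ.verts.tail ++ [s(u, u')]) ++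
        (List.zipWith (fun v w => s(v, w)) β.verts β.verts.tail ++ [s(x, y)]) := by
    rw [hQ, edges_append_cons, edges_concat hγu]
    simp only [List.cons_append, List.append_assoc, List.nil_append]
  have hwit : ∀ f ∈ List.zipWith (fun v w => s(v, w)) β.verts β.verts.tail ++ [s(x, y)],
      ∃ c ∈ f, c ∈ β.verts := by
    intro f hf
    rcases List.mem_append.1 hf with hf | hf
    · exact ⟨_, Sym2.out_fst_mem f, forall_mem_of_mem_edges _ f hf _ (Sym2.out_fst_mem f)⟩
    · rw [List.mem_singleton] at hf; subst hf
      exact ⟨_, β.getLast_mem _ (List.getLast?_eq_some_getLast hβne), List.getLast_mem hβne⟩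
  have hroot : s(u, u') ∉ List.zipWith (fun v w => s(v, w)) β.verts β.verts.tail ++ [s(x, y)] :=
    (List.nodup_cons.1 (β.edges_nodup hβne)).1
  refine ⟨⟨γ.verts ++ β.verts, ?_, ?_, ?_, ?_, ?_, ?_, fun _ => ?_, γ.fst_mem⟩, rfl⟩
  · intro v hv
    rcases List.mem_append.1 hv with hv | hv
    · exact γ.subset v hv
    · exact hSΛ (hβS v hv).1
  · rw [List.nodup_append]
    exact ⟨γ.nodup, β.nodup, fun p hp q hq hpq => (hβS q hq).2 (hpq ▸ hp)⟩
  · rw [List.isChain_append]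
    refine ⟨γ.isChain, β.isChain, fun p hp q hq => ?_⟩
    rw [Option.mem_def, hγu, Option.some.injEq] at hp
    rw [Option.mem_def, hβh, Option.some.injEq] at hq
    rw [← hp, ← hq]; exact huu'
  · intro v hv
    rw [List.head?_append, List.head?_eq_some_head hγne, Option.some_or, Option.some.injEq] at hv
    exact γ.head_mem v (by rw [← hv]; exact List.head?_eq_some_head hγne)
  · intro v hv
    rw [List.getLast?_append, List.getLast?_eq_some_getLast hβne, Option.some_or,
      Option.some.injEq] at hv
    exact β.getLast_mem v (by rw [← hv]; exact List.getLast?_eq_some_getLast hβne)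
  · intro h; simp [hγne] at h
  · rw [hE, List.nodup_append]
    refine ⟨γ.edges_nodup hγne, (List.nodup_cons.1 (β.edges_nodup hβne)).2, ?_⟩
    intro e he f hf hef
    obtain ⟨c, hcf, hcβ⟩ := hwit f hf
    rw [← hef] at hcf
    rcases List.mem_append.1 he with he | he
    · rcases List.mem_cons.1 he with he | he
      · exact haS c (he ▸ hcf) (hβS c hcβ).1
      · exact (hβS c hcβ).2 (forall_mem_of_mem_edges _ e he c hcf)
    · rw [List.mem_singleton] at he
      subst he
      subst hef
      exact hroot hf

/-- **The last entrance of a walk `a → {x,y}`** (`a` off `S`, `x, y ∈ S`): the outer block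
`P = rdropWhile (· ∈ S)` ends at a vertex `u ∈ Λ ∖ S`, the inner block `Q = rtakeWhile (· ∈ S)`
starts at `u' ∈ S` with `u ∼ u'`, and `Q ⊆ S`. -/
theorem walk_split {Λ S : Finset HexVertex} {a : Sym2 HexVertex} {x y : HexVertex}
    {p : HexVertex → Bool} (hp : ∀ v, p v = true ↔ v ∈ S) (ω : HexMidEdgeSAW Λ a s(x, y))
    (haS : ∀ t ∈ a, t ∉ S) (hx : x ∈ S) (hy : y ∈ S) :
    ∃ u u', (ω.verts.rdropWhile p).getLast? = some u ∧ (ω.verts.rtakeWhile p).head? = some u' ∧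
      u ∉ S ∧ u ∈ Λ ∧ u' ∈ S ∧ hexGraph.Adj u u' ∧ ∀ q ∈ ω.verts.rtakeWhile p, q ∈ S := by
  have hne : ω.verts ≠ [] := fun h0 =>
    haS x (by rw [ω.eq_of_nil h0]; exact Sym2.mem_mk_left x y) hx
  have hQS : ∀ q ∈ ω.verts.rtakeWhile p, q ∈ S := fun q hq =>
    (hp q).1 (List.mem_rtakeWhile_imp hq)
  have hPne : ω.verts.rdropWhile p ≠ [] := by
    intro h
    rw [List.rdropWhile_eq_nil_iff] at h
    exact haS _ (ω.head_mem _ (List.head?_eq_some_head hne)) ((hp _).1 (h _ (List.head_mem hne)))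
  have hQne : ω.verts.rtakeWhile p ≠ [] := by
    intro h
    rw [List.rtakeWhile_eq_nil_iff] at h
    refine h hne ((hp _).2 ?_)
    rcases Sym2.mem_iff.1 (ω.getLast_mem _ (List.getLast?_eq_some_getLast hne)) with h' | h' <;>
      rw [h']
    exacts [hx, hy]
  have hdec : ω.verts = ω.verts.rdropWhile p ++ ω.verts.rtakeWhile p :=
    List.rdropWhile_append_rtakeWhile.symm
  refine ⟨_, _, List.getLast?_eq_some_getLast hPne, List.head?_eq_some_head hQne, ?_, ?_,
    hQS _ (List.head_mem hQne), ?_, hQS⟩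
  · have h := List.rdropWhile_last_not p ω.verts hPne
    rwa [hp] at h
  · exact ω.subset _ ((List.rdropWhile_prefix p ω.verts).sublist.subset (List.getLast_mem hPne))
  · have hch := ω.isChain
    rw [hdec, List.isChain_append] at hch
    exact hch.2.2 _ (by rw [Option.mem_def]; exact List.getLast?_eq_some_getLast hPne) _
      (by rw [Option.mem_def]; exact List.head?_eq_some_head hQne)

/-- The configuration `cfg ω = (S ∖ P, (u, u'))` of a walk `ω : a → {x,y}` (`a` off `S`,
`x, y ∈ S`; `P` the outer block, `(u, u')` the entrance dart) is a candidate configuration. -/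
theorem cfg_mem_Conf {Λ S : Finset HexVertex} {a : Sym2 HexVertex} {x y : HexVertex}
    {p : HexVertex → Bool} (hp : ∀ v, p v = true ↔ v ∈ S) {cfg : List HexVertex → Config}
    (hcfg : ∀ (L : List HexVertex) (u u' : HexVertex), (L.rdropWhile p).getLast? = some u →
      (L.rtakeWhile p).head? = some u' → cfg L = (S \ (L.rdropWhile p).toFinset, (u, u')))
    (ω : HexMidEdgeSAW Λ a s(x, y)) (haS : ∀ t ∈ a, t ∉ S) (hx : x ∈ S) (hy : y ∈ S) :
    cfg ω.verts ∈ Conf Λ S := by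
  obtain ⟨u, u', hP, hQ, hu, huΛ, hu'S, huu', -⟩ := walk_split hp ω haS hx hy
  rw [hcfg _ _ _ hP hQ]
  simp only [Conf, entr, Finset.mem_product, Finset.mem_powerset, Finset.mem_filter]
  exact ⟨Finset.sdiff_subset, ⟨huΛ, hu'S⟩, hu, huu'⟩

/-- **One group of the factorisation.** For a candidate configuration `(D, (u, u'))`
(`D ⊆ S`, `u ∉ S`, `u ∼ u'`), the total weight of the walks `a → {x,y}` of `Λ` whose last
entrance into `S` is the dart `(u, u')` leaving the inner domain `D` behind equals
`amp(D, (u,u')) · F_{D,{u,u'}}({x,y})` (cut/glue bijection `ω ↔ (γ, β)`, multiplicative weights). -/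
theorem fiber_sum_eq {Λ S D : Finset HexVertex} {a : Sym2 HexVertex} {x y u u' : HexVertex}
    (hSΛ : S ⊆ Λ) (haS : ∀ t ∈ a, t ∉ S) (hx : x ∈ S) (hy : y ∈ S) (hDS : D ⊆ S) (hu : u ∉ S)
    (huu' : hexGraph.Adj u u') {p : HexVertex → Bool} (hp : ∀ v, p v = true ↔ v ∈ S)
    {cfg : List HexVertex → Config}
    (hcfg : ∀ (L : List HexVertex) (u u' : HexVertex), (L.rdropWhile p).getLast? = some u →
      (L.rtakeWhile p).head? = some u' → cfg L = (S \ (L.rdropWhile p).toFinset, (u, u'))) :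
    ∑ ω ∈ Finset.univ.filter (fun ω : HexMidEdgeSAW Λ a s(x, y) => cfg ω.verts = (D, (u, u'))),
        ω.weight xc (5 / 8) =
      amp Λ a S (D, (u, u')) * Fobs D s(u, u') s(x, y) := by
  set A : Finset (HexMidEdgeSAW Λ a s(x, y)) :=
    Finset.univ.filter (fun ω : HexMidEdgeSAW Λ a s(x, y) => cfg ω.verts = (D, (u, u'))) with hA
  set B : Finset (HexMidEdgeSAW Λ a s(u, u') × HexMidEdgeSAW D s(u, u') s(x, y)) :=
    (Finset.univ.filter fun γ : HexMidEdgeSAW Λ a s(u, u') =>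
      γ.verts.getLast? = some u ∧ S \ γ.verts.toFinset = D) ×ˢ Finset.univ with hB
  have hmA : ∀ ω, ω ∈ A ↔ cfg ω.verts = (D, (u, u')) := fun ω => by
    simp only [hA, Finset.mem_filter, Finset.mem_univ, true_and]
  have hmB : ∀ p, p ∈ B ↔ p.1.verts.getLast? = some u ∧ S \ p.1.verts.toFinset = D := fun p => by
    simp only [hB, Finset.mem_product, Finset.mem_filter, Finset.mem_univ, true_and, and_true]
  have hset : A.image HexMidEdgeSAW.verts = B.image (fun p => p.1.verts ++ p.2.verts) := by
    ext L
    simp only [Finset.mem_image]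
    constructor
    · rintro ⟨ω, hω, rfl⟩
      rw [hmA] at hω
      obtain ⟨u₀, u₀', hP, hQ, -, -, -, -, hQS⟩ := walk_split hp ω haS hx hy
      rw [hcfg _ _ _ hP hQ, Prod.mk.injEq, Prod.mk.injEq] at hω
      obtain ⟨hD, hu₀, hu₀'⟩ := hω
      rw [hu₀] at hP; rw [hu₀'] at hQ
      obtain ⟨γ, β, hγ, hβ⟩ :=
        exists_cut ω List.rdropWhile_append_rtakeWhile.symm hP hQ hQS hD
      refine ⟨(γ, β), (hmB _).2 ⟨?_, ?_⟩, ?_⟩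
      · rw [hγ]; exact hP
      · rw [hγ]; exact hD
      · simp only [hγ, hβ]
        exact List.rdropWhile_append_rtakeWhile
    · rintro ⟨⟨γ, β⟩, hγβ, rfl⟩
      obtain ⟨hγu, hγD⟩ := (hmB _).1 hγβ
      obtain ⟨ω, hω⟩ := exists_glue hSΛ haS hx hy hu huu' γ hγu hγD β
      obtain ⟨-, hβh⟩ := inner_head β hDS hu hx hy
      have hβS : ∀ v ∈ β.verts, v ∈ S := fun v hv => hDS (β.subset v hv)
      obtain ⟨h1, h2⟩ := rdropWhile_rtakeWhile_of_append hp hγu hu hβS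
      refine ⟨ω, (hmA ω).2 ?_, hω⟩
      rw [hω, hcfg _ u u' (by rw [h1]; exact hγu) (by rw [h2]; exact hβh), h1, hγD]
  have hinjB : ∀ e ∈ B, ∀ f ∈ B, e.1.verts ++ e.2.verts = f.1.verts ++ f.2.verts → e = f := by
    intro e he f hf h
    obtain ⟨e1, e2⟩ := rdropWhile_rtakeWhile_of_append hp ((hmB e).1 he).1 hu
      (fun v hv => hDS (e.2.subset v hv))
    obtain ⟨f1, f2⟩ := rdropWhile_rtakeWhile_of_append hp ((hmB f).1 hf).1 hu
      (fun v hv => hDS (f.2.subset v hv))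
    have d1 : e.1.verts = f.1.verts := by rw [← e1, h, f1]
    have d2 : e.2.verts = f.2.verts := by rw [← e2, h, f2]
    exact Prod.ext (HexMidEdgeSAW.ext d1) (HexMidEdgeSAW.ext d2)
  -- the weight as a function of the vertex list; multiplicative under gluing
  obtain ⟨F, hF, hFm⟩ : ∃ F : List HexVertex → ℂ,
      (∀ ω : HexMidEdgeSAW Λ a s(x, y), ω.weight xc (5 / 8) = F ω.verts) ∧
      ∀ (γ : HexMidEdgeSAW Λ a s(u, u')) (β : HexMidEdgeSAW D s(u, u') s(x, y)),
        γ.verts.getLast? = some u → β.verts.head? = some u' →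
          F (γ.verts ++ β.verts) = γ.weight xc (5 / 8) * β.weight xc (5 / 8) :=
    ⟨fun L => Complex.exp (-Complex.I * ((5 / 8 : ℝ) : ℂ) *
        ((Polyline.winding (hexMidpoint a :: L.map hexCenter ++ [hexMidpoint s(x, y)]) : ℝ) : ℂ)) *
      ((xc : ℝ) : ℂ) ^ L.length, fun _ => rfl, fun _ _ hγ hβ => weight_split hγ hβ _ _⟩
  calc ∑ ω ∈ A, ω.weight xc (5 / 8) = ∑ ω ∈ A, F ω.verts := Finset.sum_congr rfl fun ω _ => hF ω
    _ = ∑ L ∈ A.image HexMidEdgeSAW.verts, F L :=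
        (Finset.sum_image fun _ _ _ _ h => HexMidEdgeSAW.ext h).symm
    _ = ∑ L ∈ B.image (fun p => p.1.verts ++ p.2.verts), F L := by rw [hset]
    _ = ∑ p ∈ B, F (p.1.verts ++ p.2.verts) := Finset.sum_image hinjB
    _ = ∑ p ∈ B, p.1.weight xc (5 / 8) * p.2.weight xc (5 / 8) :=
        Finset.sum_congr rfl fun p hp => hFm p.1 p.2 ((hmB p).1 hp).1
          (inner_head p.2 hDS hu hx hy).2
    _ = amp Λ a S (D, (u, u')) * Fobs D s(u, u') s(x, y) := by
        rw [hB, Finset.sum_product, Finset.sum_filter, amp, Fobs, hexParafermionicObservable_def,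
          Finset.sum_mul]
        refine Finset.sum_congr rfl fun γ _ => ?_
        rw [ite_mul, zero_mul, Finset.mul_sum]

end LastEntrance

open LastEntrance

/-- **S1 — exact last-entrance factorisation.** For `S ⊆ Λ`, a root mid-edge `a` with both
endpoints off `S` and `x, y ∈ S`:
`F_{Λ,a}({x,y}) = Σ_{c ∈ Conf Λ S} amp(c) · F_{D_c, root c}({x,y})`.
Proof: group the walks `a → {x,y}` by the configuration `(S ∖ P, (u, u'))` of their last
entrance into `S` (`cfg_mem_Conf`, `Finset.sum_fiberwise_of_maps_to`); on each group the cut/glue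
bijection with multiplicative weights gives `amp · F` (`fiber_sum_eq`). -/
theorem stub_factorisation :
    ∀ (Λ S : Finset HexVertex) (a : Sym2 HexVertex) (x y : HexVertex),
      S ⊆ Λ → (∀ t ∈ a, t ∉ S) → x ∈ S → y ∈ S →
        Fobs Λ a s(x, y) = ∑ c ∈ Conf Λ S, amp Λ a S c * Fobs c.1 (root c) s(x, y) := by
  intro Λ S a x y hSΛ haS hx hy
  -- the predicate `· ∈ S` and the configuration `(S ∖ P, (last P, head Q))` of a vertex list
  obtain ⟨p, hp⟩ : ∃ p : HexVertex → Bool, ∀ v, p v = true ↔ v ∈ S :=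
    ⟨fun v => decide (v ∈ S), fun v => decide_eq_true_iff⟩
  obtain ⟨cfg, hcfg⟩ : ∃ cfg : List HexVertex → Config, ∀ (L : List HexVertex) (u u' : HexVertex),
      (L.rdropWhile p).getLast? = some u → (L.rtakeWhile p).head? = some u' →
        cfg L = (S \ (L.rdropWhile p).toFinset, (u, u')) :=
    ⟨fun L => (S \ (L.rdropWhile p).toFinset,
        ((L.rdropWhile p).getLast?.getD x, (L.rtakeWhile p).head?.getD x)),
      fun L u u' hP hQ => by simp only [hP, hQ, Option.getD_some]⟩
  have hmaps : ∀ ω ∈ (Finset.univ : Finset (HexMidEdgeSAW Λ a s(x, y))), cfg ω.verts ∈ Conf Λ S :=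
    fun ω _ => cfg_mem_Conf hp hcfg ω haS hx hy
  rw [Fobs, hexParafermionicObservable_def, ← Finset.sum_fiberwise_of_maps_to hmaps]
  refine Finset.sum_congr rfl fun c hc => ?_
  obtain ⟨D, u, u'⟩ := c
  simp only [Conf, entr, Finset.mem_product, Finset.mem_powerset, Finset.mem_filter] at hc
  obtain ⟨hDS, -, hu, huu'⟩ := hc
  exact fiber_sum_eq hSΛ haS hx hy hDS hu huu' hp hcfg

end Summit.CriticalPhenomena.SAWScalingLimit.Theorems.InteriorFlattening.OneMouth

end
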